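import Literature.GroupTheory.CocycleCentralExtension
import Mathlib.Data.Finset.Basic
import Mathlib.Tactic.Group
import HarnessLib

/-!
# Weil's group-chunk lemma: a group is presented by a generic subset and the products inside it

Topic `GroupTheory`; namespace `Literature.GroupTheory`. KERNEL mathematics only (definitions with bodies + theorems;
no named fact, no `axiom`, no `sorry`).

[Weil1964, n° 42, Lemme 6, p. 195]: "Soient `G` un groupe, et `U` une partie de `G`, tels que
`U⁻¹ ∩ Ua ∩ Ub ∩ Uc ≠ ∅` quels que soient `a, b, c` dans `G`. Soit `R` l'ensemble des éléments `(u, u', u″)` de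
`U × U × U` tels que `u″ = uu'`. Alors `G` est engendré par les éléments de `U` et peut être identifié avec le groupe
défini par ces générateurs et par les relations `u″ = uu'` pour `(u, u', u″) ∈ R`."  Weil applies it (n° 42, end,
p. 196) with `G = Ps(X) = Sp(X)` over a local field of characteristic `≠ 2` and `U = Ω(X)` (the big cell: the `s`
whose block `γ(s)` is an isomorphism, n° 32), and (n° 43, pp. 196–197, around formula (40)) in the form we need:
by [Weil1964, Chap. I n° 15, Thm 3], `r(s) r(s') = γ(f₀) r(s″)` whenever `s″ = s s'` with `s, s', s″ ∈ Ω(X)`, and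
"réciproquement, on conclut immédiatement du lemme 6 que, si `ψ` est une application de `Ω(X)` dans `T`
satisfaisant à (40), on peut, d'une manière et d'une seule, déterminer un caractère `ζ` de `Mp(X)` qui satisfasse à
`ζ ∘ r = ψ` et qui coïncide avec `θⁿ` sur `T`".

What is formalised (elementary group theory; the presentation "generators `U`, relations `R`" is stated as its
universal property — maps out of `U` respecting `R` extend uniquely to homomorphisms):

* §1 the genericity hypothesis, in the finite-family form which Weil's examples satisfy ("il en sera ainsi … quand on
  prend pour `U` le complémentaire d'une réunion de sous-variétés … de codimension `≥ 1`", n° 42): `IsLeftGeneric Ω`: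
  every finite set `T ⊆ G` has a left translate `x T ⊆ Ω` (i.e. `⋂_{t∈T} Ω t⁻¹ ≠ ∅`; Weil asks it for three
  translates and `U⁻¹`); consequences `Ω ≠ ∅`, `G = Ω⁻¹ Ω` ("soit `v ∈ U⁻¹ ∩ Ux⁻¹`; alors on a `x = v⁻¹(vx)`");
* §2 **Lemme 6 as a universal property**: a map `f : G → H` into a group with `f (a b) = f a * f b` whenever
  `a, b, a b ∈ Ω` (the relations `R`) agrees on `Ω` with a UNIQUE homomorphism `G →* H` (`IsLeftGeneric.lift`,
  `lift_eq_of_mem`, `lift_unique`; formula `g ↦ (f x)⁻¹ f (x g)` for any `x` with `x, x g ∈ Ω`);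
* §3 **the form of n° 43**: for a normalised central `2`-cocycle `c : G × G → A` and central scalars `z : A →* M`, a
  map `Φ : G → M` with `Φ a * Φ b = z (c a b) * Φ (a b)` on `Ω`-triples (Weil's (40) / Thm 3 shape
  `r(s)r(s') = γ(f₀) r(s″)`) agrees on `Ω` with a UNIQUE map `r : G → M` having multiplier `c` EVERYWHERE
  (`TwistedProduct.HasMultiplier c z r`) — obtained by applying §2 inside the twisted product `G ×_c A` to
  `(g, a) ↦ z a * Φ g`.  This is the device by which a metaplectic `2`-cocycle computed on the big cell only
  ([Weil1964, Chap. I Thm 3]; [Rangarao1993, Thm 4.1 (4)]) is pinned down on the whole symplectic group.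

## References

* [Weil1964] A. Weil, *Sur certains groupes d'opérateurs unitaires*, Acta Math. 111 (1964) 143–211: n° 42 Lemme 6
  (p. 195), n° 43 (pp. 196–197, formula (40)), Chap. I n° 7 Prop. 1, n° 15 Thm 3.
* [Rangarao1993] R. Ranga Rao, *On some explicit formulas in the theory of Weil representation*, Pacific J. Math. 157
  (1993) 335–371, §3–§4.
-/

set_option autoImplicit false

namespace Literature.GroupTheory

universe u v w

/-! ## §1 Left-generic subsets -/

section Generic

variable {G : Type u} [Group G]

/-- a subset `Ω` of a group is **left-generic** if for every finite set `T ⊆ G` some left translate `x T` lies in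
`Ω` (equivalently: every finite intersection `⋂_{t ∈ T} Ω t⁻¹` is non-empty) — the finite-family form of Weil's
hypothesis "`U⁻¹ ∩ Ua ∩ Ub ∩ Uc ≠ ∅` quels que soient `a, b, c`". [cite: Weil1964, n° 42, Lemme 6 (hypothesis), p. 195] -/
def IsLeftGeneric (Ω : Set G) : Prop :=
  ∀ T : Finset G, ∃ x : G, ∀ t ∈ T, x * t ∈ Ω

namespace IsLeftGeneric

variable {Ω : Set G}

open scoped Classical in
/-- a left-generic set is non-empty (take `T = {1}`). [cite: Weil1964, n° 42, Lemme 6, p. 195] -/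
theorem nonempty (hΩ : IsLeftGeneric Ω) : Ω.Nonempty := by
  obtain ⟨x, hx⟩ := hΩ {1}
  exact ⟨x * 1, hx 1 (Finset.mem_singleton_self 1)⟩

open scoped Classical in
/-- for every `g` there is `x` with `x ∈ Ω` and `x g ∈ Ω` (Weil: "soit `v ∈ U⁻¹ ∩ Ux⁻¹`").
[cite: Weil1964, n° 42, Lemme 6 (proof), p. 195] -/
theorem exists_mem_mul_mem (hΩ : IsLeftGeneric Ω) (g : G) : ∃ x : G, x ∈ Ω ∧ x * g ∈ Ω := by
  obtain ⟨x, hx⟩ := hΩ {1, g}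
  refine ⟨x, ?_, hx g (by simp)⟩
  simpa using hx 1 (by simp)

open scoped Classical in
/-- for every `g, h` there is `x` with `x, x g, x h ∈ Ω`. [cite: Weil1964, n° 42, Lemme 6 (hypothesis), p. 195] -/
theorem exists_mem_mul_mem₂ (hΩ : IsLeftGeneric Ω) (g h : G) :
    ∃ x : G, x ∈ Ω ∧ x * g ∈ Ω ∧ x * h ∈ Ω := by
  obtain ⟨x, hx⟩ := hΩ {1, g, h}
  refine ⟨x, ?_, hx g (by simp), hx h (by simp)⟩
  simpa using hx 1 (by simp)

open scoped Classical in
/-- for every `g, h, k` there is `x` with `x, x g, x h, x k ∈ Ω` (Weil's "`U⁻¹ ∩ Ua ∩ Ub ∩ Uc ≠ ∅`" with `x = v⁻¹`).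
[cite: Weil1964, n° 42, Lemme 6 (hypothesis), p. 195] -/
theorem exists_mem_mul_mem₃ (hΩ : IsLeftGeneric Ω) (g h k : G) :
    ∃ x : G, x ∈ Ω ∧ x * g ∈ Ω ∧ x * h ∈ Ω ∧ x * k ∈ Ω := by
  obtain ⟨x, hx⟩ := hΩ {1, g, h, k}
  refine ⟨x, ?_, hx g (by simp), hx h (by simp), hx k (by simp)⟩
  simpa using hx 1 (by simp)

/-- every element is a quotient `x⁻¹ y` of two elements of a left-generic set (`G = Ω⁻¹ Ω`; Weil: "alors on a
`x = v⁻¹(vx)` et `v⁻¹ ∈ U`, `vx ∈ U`, ce qui justifie la première assertion" — `G` is generated by `U`).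
[cite: Weil1964, n° 42, Lemme 6, p. 195] -/
theorem exists_eq_inv_mul (hΩ : IsLeftGeneric Ω) (g : G) : ∃ x ∈ Ω, ∃ y ∈ Ω, g = x⁻¹ * y := by
  obtain ⟨x, hx, hxg⟩ := hΩ.exists_mem_mul_mem g
  exact ⟨x, hx, x * g, hxg, by rw [inv_mul_cancel_left]⟩

/-- left-genericity is inherited by bigger sets. [cite: Weil1964, n° 42, Lemme 6 (hypothesis), p. 195] -/
theorem mono {Ω' : Set G} (hΩ : IsLeftGeneric Ω) (h : Ω ⊆ Ω') : IsLeftGeneric Ω' := fun T => by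
  obtain ⟨x, hx⟩ := hΩ T
  exact ⟨x, fun t ht => h (hx t ht)⟩

/-- left-genericity pulls back along a surjective homomorphism: `p⁻¹ Ω` is left-generic in `E` if `Ω` is in `G`
(used for `E = Mp(X) → Sp(X)`, `Ω = Ω(X)` in n° 43). [cite: Weil1964, n° 42–43, Lemme 6, pp. 195–196] -/
theorem comap {E : Type w} [Group E] (hΩ : IsLeftGeneric Ω) (p : E →* G) (hp : Function.Surjective p) :
    IsLeftGeneric ((p : E → G) ⁻¹' Ω) := by
  classical
  intro T
  obtain ⟨x, hx⟩ := hΩ (T.image p)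
  obtain ⟨e, rfl⟩ := hp x
  refine ⟨e, fun t ht => ?_⟩
  show p (e * t) ∈ Ω
  rw [map_mul]
  exact hx (p t) (Finset.mem_image_of_mem p ht)

end IsLeftGeneric

end Generic

/-! ## §2 The chunk lemma: a partial homomorphism on a left-generic set extends uniquely -/

section Chunk

variable {G : Type u} [Group G] {H : Type v} [Group H] {Ω : Set G}

/-- a map is a **partial homomorphism on `Ω`** if `f (a b) = f a * f b` whenever `a, b, a b ∈ Ω` — it respects
Weil's relations `R = {(u, u', u″) ∈ U³ | u″ = uu'}`. [cite: Weil1964, n° 42, Lemme 6 (the set R), p. 195] -/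
def IsMulOn (Ω : Set G) (f : G → H) : Prop :=
  ∀ a ∈ Ω, ∀ b ∈ Ω, a * b ∈ Ω → f (a * b) = f a * f b

namespace IsLeftGeneric

variable (hΩ : IsLeftGeneric Ω) {f : G → H} (hf : IsMulOn Ω f)
include hΩ hf

/-- KEY STEP: the quotient `(f x)⁻¹ f (x g)` does not depend on the choice of `x` with `x, x g ∈ Ω`.  Proof: pick `y`
with `y, y x, y x g, y x x'⁻¹ ∈ Ω` (genericity); then `(f x)⁻¹ f(x g) = (f (y x))⁻¹ f (y x g)` (expand `f(yx)`,
`f(yxg)` by multiplicativity) and, with `y' = y x x'⁻¹ ∈ Ω`, `y x = y' x'`, the same expression equals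
`(f x')⁻¹ f (x' g)`. [cite: Weil1964, n° 42, Lemme 6 (proof), p. 195] -/
theorem inv_mul_eq_inv_mul {g x x' : G} (hx : x ∈ Ω) (hxg : x * g ∈ Ω) (hx' : x' ∈ Ω) (hx'g : x' * g ∈ Ω) :
    (f x)⁻¹ * f (x * g) = (f x')⁻¹ * f (x' * g) := by
  obtain ⟨y, hy, hyx, hyxg, hyxx'⟩ := hΩ.exists_mem_mul_mem₃ x (x * g) (x * x'⁻¹)
  -- `y' = y x x'⁻¹`
  have e₁ : y * (x * x'⁻¹) * x' = y * x := by group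
  have e₂ : y * (x * x'⁻¹) * (x' * g) = y * (x * g) := by group
  have h₁ : f (y * x) = f y * f x := hf y hy x hx hyx
  have h₂ : f (y * (x * g)) = f y * f (x * g) := hf y hy (x * g) hxg hyxg
  have h₃ : f (y * x) = f (y * (x * x'⁻¹)) * f x' := by
    rw [← e₁]; exact hf _ hyxx' x' hx' (e₁ ▸ hyx)
  have h₄ : f (y * (x * g)) = f (y * (x * x'⁻¹)) * f (x' * g) := by
    rw [← e₂]; exact hf _ hyxx' (x' * g) hx'g (e₂ ▸ hyxg)
  -- both sides equal `(f (y x))⁻¹ f (y x g)`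
  calc (f x)⁻¹ * f (x * g) = (f y * f x)⁻¹ * (f y * f (x * g)) := by group
    _ = (f (y * x))⁻¹ * f (y * (x * g)) := by rw [h₁, h₂]
    _ = (f (y * (x * x'⁻¹)) * f x')⁻¹ * (f (y * (x * x'⁻¹)) * f (x' * g)) := by rw [h₃, h₄]
    _ = (f x')⁻¹ * f (x' * g) := by group

/-- the extension as a bare function: `g ↦ (f x)⁻¹ f (x g)` for a chosen `x` with `x, x g ∈ Ω` (non-Prop
plumbing). [cite: Weil1964, n° 42, Lemme 6, p. 195] -/
noncomputable def liftFun (_hf : IsMulOn Ω f) (g : G) : H :=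
  (f (Classical.choose (hΩ.exists_mem_mul_mem g)))⁻¹ * f (Classical.choose (hΩ.exists_mem_mul_mem g) * g)

/-- the defining formula holds for EVERY admissible `x`. [cite: Weil1964, n° 42, Lemme 6 (proof), p. 195] -/
theorem liftFun_eq {g x : G} (hx : x ∈ Ω) (hxg : x * g ∈ Ω) : hΩ.liftFun hf g = (f x)⁻¹ * f (x * g) :=
  hΩ.inv_mul_eq_inv_mul hf (Classical.choose_spec (hΩ.exists_mem_mul_mem g)).1
    (Classical.choose_spec (hΩ.exists_mem_mul_mem g)).2 hx hxg

/-- on `Ω` the extension is `f`. [cite: Weil1964, n° 42, Lemme 6, p. 195] -/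
theorem liftFun_eq_of_mem {a : G} (ha : a ∈ Ω) : hΩ.liftFun hf a = f a := by
  obtain ⟨x, hx, hxa⟩ := hΩ.exists_mem_mul_mem a
  rw [hΩ.liftFun_eq hf hx hxa, hf x hx a ha hxa, inv_mul_cancel_left]

/-- the extension is multiplicative: choose `x` with `x, x g, x g h ∈ Ω` and use `x g` as the witness for `h`.
[cite: Weil1964, n° 42, Lemme 6 (proof), p. 195] -/
theorem liftFun_mul (g h : G) : hΩ.liftFun hf (g * h) = hΩ.liftFun hf g * hΩ.liftFun hf h := by
  obtain ⟨x, hx, hxg, hxgh⟩ := hΩ.exists_mem_mul_mem₂ g (g * h)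
  rw [hΩ.liftFun_eq hf hx hxgh, hΩ.liftFun_eq hf hx hxg,
    hΩ.liftFun_eq hf hxg (show x * g * h ∈ Ω by rwa [mul_assoc]), mul_assoc x g h]
  group

/-- **Lemme 6 (existence half of the universal property of the presentation `⟨U | R⟩ = G`)**: the homomorphism
`G →* H` extending a partial homomorphism on a left-generic set. [cite: Weil1964, n° 42, Lemme 6, p. 195] -/
noncomputable def lift : G →* H :=
  MonoidHom.mk' (hΩ.liftFun hf) (hΩ.liftFun_mul hf)

/-- formula `lift g = (f x)⁻¹ f (x g)` for any `x` with `x, x g ∈ Ω`. [cite: Weil1964, n° 42, Lemme 6, p. 195] -/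
theorem lift_eq {g x : G} (hx : x ∈ Ω) (hxg : x * g ∈ Ω) : (hΩ.lift hf) g = (f x)⁻¹ * f (x * g) :=
  hΩ.liftFun_eq hf hx hxg

/-- `lift` extends `f` on `Ω` (the generators `ū ↦ u`). [cite: Weil1964, n° 42, Lemme 6, p. 195] -/
theorem lift_eq_of_mem {a : G} (ha : a ∈ Ω) : (hΩ.lift hf) a = f a := hΩ.liftFun_eq_of_mem hf ha

/-- **Lemme 6 (uniqueness half: `G` is generated by `U`)**: a homomorphism agreeing with `f` on `Ω` is `lift`.
[cite: Weil1964, n° 42, Lemme 6, p. 195] -/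
theorem lift_unique (F : G →* H) (hF : ∀ a ∈ Ω, F a = f a) : F = hΩ.lift hf := by
  ext g
  obtain ⟨x, hx, hxg⟩ := hΩ.exists_mem_mul_mem g
  rw [hΩ.lift_eq hf hx hxg, ← hF x hx, ← hF (x * g) hxg, map_mul, inv_mul_cancel_left]

/-- two homomorphisms agreeing with `f` on `Ω` are equal. [cite: Weil1964, n° 42, Lemme 6, p. 195] -/
theorem hom_ext (F F' : G →* H) (hF : ∀ a ∈ Ω, F a = f a) (hF' : ∀ a ∈ Ω, F' a = f a) : F = F' := by
  rw [hΩ.lift_unique hf F hF, hΩ.lift_unique hf F' hF']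

end IsLeftGeneric

/-- two homomorphisms which agree on a left-generic set are equal ("`G` est engendré par les éléments de `U`").
[cite: Weil1964, n° 42, Lemme 6, p. 195] -/
theorem MonoidHom.eq_of_eqOn_leftGeneric (hΩ : IsLeftGeneric Ω) (F F' : G →* H) (h : ∀ a ∈ Ω, F a = F' a) :
    F = F' :=
  hΩ.hom_ext (f := F) (fun a _ b _ _ => map_mul F a b) F F' (fun _ _ => rfl) fun a ha => (h a ha).symm

end Chunk

/-! ## §3 The version with a prescribed cocycle: a multiplier identity on the chunk holds everywhere -/

section Multiplier

variable {G : Type u} [Group G] {A : Type v} [CommGroup A] {M : Type w} [Group M]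
variable (c : CentralCocycle G A) (z : A →* M) {Ω : Set G}

/-- a map `Φ : G → M` **has multiplier `c` on `Ω`** (relative to the scalars `z`) if
`Φ a * Φ b = z (c a b) * Φ (a b)` whenever `a, b, a b ∈ Ω` — the relation [Rangarao1993, (4.1)] restricted to
`Ω`-triples; Weil's (40) `ψ(s″) = γ(f₀)⁻¹ ψ(s) ψ(s')` / Thm 3 `r(s) r(s') = γ(f₀) r(s″)` for `s″ = ss'`,
`s, s', s″ ∈ Ω(X)`. [cite: Weil1964, n° 43, (40), pp. 196–197] -/
def HasMultiplierOn (Ω : Set G) (Φ : G → M) : Prop :=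
  ∀ a ∈ Ω, ∀ b ∈ Ω, a * b ∈ Ω → Φ a * Φ b = z (c a b) * Φ (a * b)

variable {c z}

/-- `HasMultiplier` (everywhere) is `HasMultiplierOn univ`. [cite: Weil1964, n° 43, (40), pp. 196–197] -/
theorem hasMultiplierOn_univ_iff (Φ : G → M) :
    HasMultiplierOn c z Set.univ Φ ↔ TwistedProduct.HasMultiplier c z Φ :=
  ⟨fun h g₁ g₂ => h g₁ trivial g₂ trivial trivial, fun h a _ b _ _ => h a b⟩

namespace HasMultiplierOn

variable (hΩ : IsLeftGeneric Ω) (hz : ∀ a, z a ∈ Subgroup.center M) {Φ : G → M}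
  (hΦ : HasMultiplierOn c z Ω Φ)
include hz hΦ

/-- the map `(g, a) ↦ z a * Φ g` is a partial homomorphism on the chunk `fst⁻¹ Ω` of the twisted product `G ×_c A`
(`z` central) — Lemme 6 is applied in the covering group, as in n° 43. [cite: Weil1964, n° 43, pp. 196–197] -/
theorem isMulOn_twistedProduct :
    IsMulOn ((TwistedProduct.fst c : TwistedProduct c → G) ⁻¹' Ω)
      (fun e : TwistedProduct c => z e.a * Φ e.g) := by
  intro e he e' he' hee'
  have hc : Φ e.g * Φ e'.g = z (c e.g e'.g) * Φ (e.g * e'.g) := hΦ e.g he e'.g he' hee'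
  have comm : Φ e.g * z e'.a = z e'.a * Φ e.g := Subgroup.mem_center_iff.1 (hz e'.a) (Φ e.g)
  show z (e * e').a * Φ (e * e').g = z e.a * Φ e.g * (z e'.a * Φ e'.g)
  rw [TwistedProduct.mul_a, TwistedProduct.mul_g, map_mul, map_mul]
  calc z e.a * z e'.a * z (c e.g e'.g) * Φ (e.g * e'.g)
      = z e.a * z e'.a * (z (c e.g e'.g) * Φ (e.g * e'.g)) := by simp only [mul_assoc]
    _ = z e.a * z e'.a * (Φ e.g * Φ e'.g) := by rw [hc]
    _ = z e.a * (z e'.a * Φ e.g) * Φ e'.g := by simp only [mul_assoc]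
    _ = z e.a * (Φ e.g * z e'.a) * Φ e'.g := by rw [comm]
    _ = z e.a * Φ e.g * (z e'.a * Φ e'.g) := by simp only [mul_assoc]

include hΩ

/-- the homomorphism `G ×_c A →* M` extending `(g, a) ↦ z a * Φ g` from the chunk ("on peut, d'une manière et
d'une seule, déterminer un caractère `ζ` de `Mp(X)` …"). [cite: Weil1964, n° 43, pp. 196–197] -/
noncomputable def liftTwisted : TwistedProduct c →* M :=
  (hΩ.comap (TwistedProduct.fst c) TwistedProduct.fst_surjective).lift (isMulOn_twistedProduct hz hΦ)

/-- on the chunk, `liftTwisted (g, a) = z a * Φ g` ("… qui satisfasse à `ζ ∘ r = ψ`"). [cite: Weil1964, n° 43, pp. 196–197] -/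
theorem liftTwisted_eq_of_mem (e : TwistedProduct c) (he : e.g ∈ Ω) :
    (liftTwisted hΩ hz hΦ) e = z e.a * Φ e.g :=
  (hΩ.comap (TwistedProduct.fst c) TwistedProduct.fst_surjective).lift_eq_of_mem
    (isMulOn_twistedProduct hz hΦ) (a := e) he

/-- `liftTwisted` restricted to the central `A` is `z`: `(1, a) = (x, 1)⁻¹ (x, a)` for `x ∈ Ω` ("… et qui coïncide
avec `θⁿ` sur `T`"). [cite: Weil1964, n° 43, pp. 196–197] -/
theorem liftTwisted_inl (a : A) : (liftTwisted hΩ hz hΦ) (TwistedProduct.inl c a) = z a := by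
  obtain ⟨x, hx⟩ := hΩ.nonempty
  have e : TwistedProduct.inl c a = (TwistedProduct.sec c x)⁻¹ * (⟨x, a⟩ : TwistedProduct c) := by
    rw [eq_inv_mul_iff_mul_eq, TwistedProduct.sec_mul_inl]
  have comm : Φ x * z a = z a * Φ x := Subgroup.mem_center_iff.1 (hz a) (Φ x)
  rw [e, map_mul, map_inv, liftTwisted_eq_of_mem hΩ hz hΦ _ (show x ∈ Ω from hx),
    liftTwisted_eq_of_mem hΩ hz hΦ _ (show x ∈ Ω from hx)]
  simp only [TwistedProduct.sec_a, TwistedProduct.sec_g, map_one, one_mul]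
  rw [← comm, inv_mul_cancel_left]

/-- **the extension with multiplier `c`**: `r g := liftTwisted (g, 1)` (non-Prop plumbing). [cite: Weil1964, n° 43, pp. 196–197] -/
noncomputable def lift (g : G) : M := (liftTwisted hΩ hz hΦ) (TwistedProduct.sec c g)

/-- `r = Φ` on `Ω`. [cite: Weil1964, n° 43, pp. 196–197] -/
theorem lift_eq_of_mem {a : G} (ha : a ∈ Ω) : lift hΩ hz hΦ a = Φ a := by
  rw [lift, liftTwisted_eq_of_mem hΩ hz hΦ _ (show a ∈ Ω from ha)]
  simp only [TwistedProduct.sec_a, TwistedProduct.sec_g, map_one, one_mul]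

/-- `r 1 = 1`. [cite: Weil1964, n° 43, pp. 196–197] -/
theorem lift_one : lift hΩ hz hΦ 1 = 1 := by
  rw [lift]
  exact map_one _

/-- **`r g₁ * r g₂ = z (c g₁ g₂) * r (g₁ g₂)` for ALL `g₁, g₂`** (`(g₁,1)(g₂,1) = (1, c(g₁,g₂)) (g₁g₂, 1)` in
`G ×_c A`). [cite: Weil1964, n° 43, (40), pp. 196–197] -/
theorem hasMultiplier_lift : TwistedProduct.HasMultiplier c z (lift hΩ hz hΦ) := by
  intro g₁ g₂
  simp only [lift]
  rw [← map_mul, TwistedProduct.sec_mul_sec, map_mul, liftTwisted_inl hΩ hz hΦ]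

/-- formula for `r` off the chunk: `r g = (Φ x)⁻¹ * z (c x g) * Φ (x g)` for any `x` with `x, x g ∈ Ω`.
[cite: Weil1964, n° 43, pp. 196–197] -/
theorem lift_eq {g x : G} (hx : x ∈ Ω) (hxg : x * g ∈ Ω) :
    lift hΩ hz hΦ g = (Φ x)⁻¹ * (z (c x g) * Φ (x * g)) := by
  rw [eq_inv_mul_iff_mul_eq, ← lift_eq_of_mem hΩ hz hΦ hx, ← lift_eq_of_mem hΩ hz hΦ hxg]
  exact hasMultiplier_lift hΩ hz hΦ x g

omit hΦ in
/-- **uniqueness** ("d'une manière et d'une seule"): a map with multiplier `c` everywhere which agrees with `Φ` on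
`Ω` is `r`. [cite: Weil1964, n° 43, pp. 196–197] -/
theorem lift_unique (hΦ : HasMultiplierOn c z Ω Φ) (r : G → M) (hr : TwistedProduct.HasMultiplier c z r)
    (hrΦ : ∀ a ∈ Ω, r a = Φ a) : r = lift hΩ hz hΦ := by
  funext g
  obtain ⟨x, hx, hxg⟩ := hΩ.exists_mem_mul_mem g
  rw [lift_eq hΩ hz hΦ hx hxg, ← hrΦ x hx, ← hrΦ (x * g) hxg, eq_inv_mul_iff_mul_eq]
  exact hr x g

end HasMultiplierOn

/-- **existence and uniqueness packaged**: a multiplier identity with cocycle `c` on a left-generic chunk is the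
restriction of a unique map with multiplier `c` on the whole group. [cite: Weil1964, n° 43, (40), pp. 196–197] -/
theorem existsUnique_hasMultiplier_of_hasMultiplierOn (hΩ : IsLeftGeneric Ω)
    (hz : ∀ a, z a ∈ Subgroup.center M) {Φ : G → M} (hΦ : HasMultiplierOn c z Ω Φ) :
    ∃! r : G → M, TwistedProduct.HasMultiplier c z r ∧ ∀ a ∈ Ω, r a = Φ a :=
  ⟨HasMultiplierOn.lift hΩ hz hΦ, ⟨HasMultiplierOn.hasMultiplier_lift hΩ hz hΦ,
    fun _ ha => HasMultiplierOn.lift_eq_of_mem hΩ hz hΦ ha⟩,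
    fun r hr => HasMultiplierOn.lift_unique hΩ hz hΦ r hr.1 hr.2⟩

/-- **a map has at most one multiplier** (`z` injective): `z (c g₁ g₂) = r g₁ r g₂ (r (g₁g₂))⁻¹`; so the
`2`-cocycle of a projective representation is determined by the operators, and — with the uniqueness above — by
their values on the big cell. [cite: Weil1964, n° 43, (40), pp. 196–197] -/
theorem cocycle_eq_of_hasMultiplier (hzi : Function.Injective z) {r : G → M} {c' : CentralCocycle G A}
    (hr : TwistedProduct.HasMultiplier c z r) (hr' : TwistedProduct.HasMultiplier c' z r) : c = c' := by
  ext g₁ g₂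
  apply hzi
  have h := (hr g₁ g₂).symm.trans (hr' g₁ g₂)
  exact mul_right_cancel h

end Multiplier

end Literature.GroupTheory
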